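import Mathlib
import HarnessLib
import Summits.HubbardSuperconductivity.HubbardSuperconductivity.Theorems.KLProgrammeKLRegimeVolumeLimitV9GluedSrcPairDoorAt

/-!
# Route `KLProgramme` — crux K3, VL child (stmt-HubbardSuperconductivity-20440), keying «(VL)-SRC-WINDOW» (R227)/(R236) (β), lemma (N1):
# SOURCE-PAIR KERNELS OF A DOUBLED-ANALYSED ACTION WHOSE SOURCE LEGS READ A ONE-SECTOR MULTIPLIER FAMILY — the `n⋆` dictionary, generic in the analysis

Cell gate-hubbard-kl, seat p1 g22.  Twin of `…VolumeLimitV9GluedSrcPairDoorAt` §1 / `…TwoVolumeSourceReadoutAt.kernel_klSrcActionAt_src` for ANY doubled analysis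
matrix `A : Matrix (SrcLabel L M J) (HubbardFieldIdx L M) ℂ` whose copy-`1` rows in sector slot `0` are the rows of `E(F)` = `sectorAnalysisMatrix L M β F` at the
relabelled one-sector leg (`F : Fin 1 → FreqMomentum L M → ℂ`) and whose other copy-`1` rows vanish — the shape of k3c4-p1's windowed analysis
`klSrcAnalysisAtW` (`F = srcWindowFamily`, `…TwoVolumeSourceSmoothDefs.klSrcAnalysisAtW_apply`) as well as of `klSrcAnalysisAt` (`F = trivialMultiplier`):
* `kernel_map_family_src` — all-source slot-`0` strings: `kernel (map (toLin' A) 𝒱) m X = sectorisedKernel β F 𝒱 m (relabel ∘ X) (pos ∘ X)`;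
  `kernel_map_family_eq_zero_of_dead` — a dead source leg kills the string; `kernel_map_smul_family` — `c • A` costs `c^m`;
* **`kernel_srcTrunc_map_smul_family_src_two`** / `…_dead_two` — through `srcTrunc 3`, degree 2: `= c²·sectorisedKernel β F 𝒱 2 …` on slot-`0` source pairs, `= 0`
  with a dead leg; **`kernel_srcTrunc_map_smul_family_pair`** — the `(+,−)` source pair at `(x,y)`, spin `↑`: `c²·W^F_𝒱(x,y)`,
  `W^F_𝒱 = sectorisedKernel β F 𝒱 2 ((0,0,+),(0,0,−))`.

Proofs only; no definition; nothing asserts HB1W, (β), any VL stub, K3 or superconductivity.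
References: BGM 2006 §2.7 (2.70)–(2.71), §2.9 (4.3)–(4.6) [cite: BenfattoGiulianiMastropietro2006].
-/

noncomputable section

namespace Summit.HubbardSuperconductivity.HubbardSuperconductivity.Theorems.TwoVolumeSource

set_option linter.dupNamespace false -- summit = problem name (single-conjunct summit), D-0017

open Finset Literature.MathematicalPhysics.QuantumLattice Literature.Probability.LatticeModels GrassmannAlgebra
open Summit.HubbardSuperconductivity.HubbardSuperconductivity.Theorems.KLProgrammeLegKernels
open Summit.HubbardSuperconductivity.HubbardSuperconductivity.Theorems.KLRegimeSplit
open Summit.HubbardSuperconductivity.HubbardSuperconductivity.Theorems.TwoVolumeDefect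
open Summit.HubbardSuperconductivity.HubbardSuperconductivity.Theorems.EngineV8

variable {L M : ℕ} [NeZero L]

/-- **All-source slot-`0` strings read the `F`-sectorised kernels of `𝒱`** (rows dictionary ∘ `kernel_map_sectorAnalysis`). -/
theorem kernel_map_family_src {J : ℕ} (A : Matrix (SrcLabel L M J) (HubbardFieldIdx L M) ℂ) (β : ℝ) (F : Fin 1 → FreqMomentum L M → ℂ)
    (hsrc : ∀ Y : SrcLabel L M J, Y.2 = 1 → (Y.1.2.1.1 : ℕ) = 0 →
      A Y = sectorAnalysisMatrix L M β F (Y.1.1, (((0 : Fin 1), Y.1.2.1.2), Y.1.2.2)))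
    (G : HubbardGrassmann L M) (m : ℕ) (X : Fin m → SrcLabel L M J) (hX : ∀ i, (X i).2 = 1) (h0 : ∀ i, ((X i).1.2.1.1 : ℕ) = 0) :
    kernel ℂ (ExteriorAlgebra.map (Matrix.toLin' A) G) m X =
      sectorisedKernel L M β F G m (fun i => ((((0 : Fin 1), (X i).1.2.1.2), (X i).1.2.2) : SectorLeg 1)) (fun i => (X i).1.1) := by
  rw [kernel_map_toLin'_eq_of_rows_eq A (sectorAnalysisMatrix L M β F) _ m X
      (fun i => ((X i).1.1, (((0 : Fin 1), (X i).1.2.1.2), (X i).1.2.2))) fun i => hsrc (X i) (hX i) (h0 i),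
    kernel_map_sectorAnalysis]

/-- **A dead source leg kills the string.** -/
theorem kernel_map_family_eq_zero_of_dead {J : ℕ} (A : Matrix (SrcLabel L M J) (HubbardFieldIdx L M) ℂ)
    (hdead : ∀ Y : SrcLabel L M J, Y.2 = 1 → (Y.1.2.1.1 : ℕ) ≠ 0 → A Y = 0)
    (G : HubbardGrassmann L M) (m : ℕ) (X : Fin m → SrcLabel L M J) {i : Fin m} (hX : (X i).2 = 1) (h0 : ((X i).1.2.1.1 : ℕ) ≠ 0) :
    kernel ℂ (ExteriorAlgebra.map (Matrix.toLin' A) G) m X = 0 :=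
  kernel_map_toLin'_eq_zero_of_row_eq_zero _ _ m X (i := i) (hdead (X i) hX h0)

/-- **A scalar multiple of the analysis costs `c^m` on degree-`m` kernels.** -/
theorem kernel_map_smul_family {J : ℕ} (c : ℂ) (A : Matrix (SrcLabel L M J) (HubbardFieldIdx L M) ℂ) (G : HubbardGrassmann L M)
    (m : ℕ) (X : Fin m → SrcLabel L M J) :
    kernel ℂ (ExteriorAlgebra.map (Matrix.toLin' (c • A)) G) m X = c ^ m * kernel ℂ (ExteriorAlgebra.map (Matrix.toLin' A) G) m X := by
  rw [map_toLin'_eq_map_mulLeft_map_of_rowScale (fun _ : SrcLabel L M J => c) (c • A) A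
      (fun p Y => by rw [Matrix.smul_apply, smul_eq_mul]) G, kernel_map_mulLeft, Fin.prod_const]

/-- **Through `srcTrunc 3`, degree 2, slot-`0` source pairs**: `= c²·sectorisedKernel β F 𝒱 2 (relabel) (pos)`. -/
theorem kernel_srcTrunc_map_smul_family_src_two {J : ℕ} (c : ℂ) (A : Matrix (SrcLabel L M J) (HubbardFieldIdx L M) ℂ) (β : ℝ)
    (F : Fin 1 → FreqMomentum L M → ℂ)
    (hsrc : ∀ Y : SrcLabel L M J, Y.2 = 1 → (Y.1.2.1.1 : ℕ) = 0 →
      A Y = sectorAnalysisMatrix L M β F (Y.1.1, (((0 : Fin 1), Y.1.2.1.2), Y.1.2.2)))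
    (G : HubbardGrassmann L M) (X : Fin 2 → SrcLabel L M J) (hX : ∀ i, (X i).2 = 1) (h0 : ∀ i, ((X i).1.2.1.1 : ℕ) = 0) :
    kernel ℂ (srcTrunc ℂ (fun Y : SrcLabel L M J => Y.2 = 1) 3 (ExteriorAlgebra.map (Matrix.toLin' (c • A)) G)) 2 X =
      c ^ 2 * sectorisedKernel L M β F G 2 (fun i => ((((0 : Fin 1), (X i).1.2.1.2), (X i).1.2.2) : SectorLeg 1)) (fun i => (X i).1.1) := by
  rw [kernel_srcTrunc_three_two, kernel_map_smul_family, kernel_map_family_src A β F hsrc G 2 X hX h0]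

/-- **Through `srcTrunc 3`, degree 2, a dead source leg**: `= 0`. -/
theorem kernel_srcTrunc_map_smul_family_dead_two {J : ℕ} (c : ℂ) (A : Matrix (SrcLabel L M J) (HubbardFieldIdx L M) ℂ)
    (hdead : ∀ Y : SrcLabel L M J, Y.2 = 1 → (Y.1.2.1.1 : ℕ) ≠ 0 → A Y = 0)
    (G : HubbardGrassmann L M) (X : Fin 2 → SrcLabel L M J) {i : Fin 2} (hX : (X i).2 = 1) (h0 : ((X i).1.2.1.1 : ℕ) ≠ 0) :
    kernel ℂ (srcTrunc ℂ (fun Y : SrcLabel L M J => Y.2 = 1) 3 (ExteriorAlgebra.map (Matrix.toLin' (c • A)) G)) 2 X = 0 := by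
  rw [kernel_srcTrunc_three_two, kernel_map_smul_family, kernel_map_family_eq_zero_of_dead A hdead G 2 X hX h0, mul_zero]

/-- **THE `n⋆` DICTIONARY AT THE END DOORS' PINS, `F`-family form**: the `(+,−)` source pair at `(x, y)`, spin `↑`, sector slot `0`, read through `srcTrunc 3` of the
`c`-scaled object, IS `c²·W^F_𝒱(x,y)`, `W^F_𝒱 = sectorisedKernel β F 𝒱 2 ((0,0,+),(0,0,−))`. -/
theorem kernel_srcTrunc_map_smul_family_pair {J : ℕ} (c : ℂ) (A : Matrix (SrcLabel L M J) (HubbardFieldIdx L M) ℂ) (β : ℝ)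
    (F : Fin 1 → FreqMomentum L M → ℂ)
    (hsrc : ∀ Y : SrcLabel L M J, Y.2 = 1 → (Y.1.2.1.1 : ℕ) = 0 →
      A Y = sectorAnalysisMatrix L M β F (Y.1.1, (((0 : Fin 1), Y.1.2.1.2), Y.1.2.2)))
    (G : HubbardGrassmann L M) (x y : SpaceTimeIdx L M) :
    kernel ℂ (srcTrunc ℂ (fun Y : SrcLabel L M J => Y.2 = 1) 3 (ExteriorAlgebra.map (Matrix.toLin' (c • A)) G)) 2
        ![((x, ((⟨0, sectorCount_pos J⟩, 0), 0)), 1), ((y, ((⟨0, sectorCount_pos J⟩, 0), 1)), 1)] =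
      c ^ 2 * sectorisedKernel L M β F G 2 (![((0, 0), 0), ((0, 0), 1)] : Fin 2 → SectorLeg 1) ![x, y] := by
  rw [kernel_srcTrunc_map_smul_family_src_two c A β F hsrc G _ (fun i => by fin_cases i <;> rfl) (fun i => by fin_cases i <;> rfl)]
  congr 2 <;> funext i <;> fin_cases i <;> rfl

end Summit.HubbardSuperconductivity.HubbardSuperconductivity.Theorems.TwoVolumeSource

end
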